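import Literature.AlgebraicGeometry.Frobenioids.PerfFactorialWeak
import Literature.AlgebraicGeometry.Frobenioids.PerfFactorialPrimes
import Literature.AlgebraicGeometry.Frobenioids.MonoidTransport
import Literature.AlgebraicGeometry.Frobenioids.MonoprimeAutomorphisms
import Literature.AlgebraicGeometry.Frobenioids.PerfectionDivisorial
import Literature.AlgebraicGeometry.Frobenioids.ArithmeticFrobenioidNonDilating
import HarnessLib

/-!
# Rigidity of weakly perf-factorial monoids with `ℤ`-monoprime components:
# every automorphism is non-dilating ([FrdI] Def. 1.1 (i))

Mochizuki, *The geometry of Frobenioids I*, Kyushu J. Math. **62** (2008): Def. 1.1 (i) p. 19 (an endomorphism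
`α` of a monoid `M` is *non-dilating* if "`α^char(a) ≼ a` for all primary `a ∈ M^char`" forces `α^char = id`),
Def. 2.4 (i) p. 47 (perf-factorial monoids: the factorization map `M^pf ↪ ∏_𝔮 M^rlf_𝔮`,
`a ↦ (sup Bound_{𝔮 ∪ {0}}(a))_𝔮`) [cite: MochizukiFrdI2008, Def. 1.1(i) p.19; Def. 2.4(i) p.47].

abc-iut cell, block C / W6 cone prover abc-iut-w6-d057 (W6-TRANCHE-2 row **EtTh:Prop3.4(i)**, the NON-DILATING
clause, general engine).  PROOF-ONLY (theorems only), in the cell's weak vocabulary of record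
(`IsPerfFactorialWeak`, abc-iut-L1 / GAP-LEDGER G-L2d2-1).

MAIN RESULT (`IsPerfFactorialWeak.mulEquiv_apply_eq_self_of_forall_isPrimary_precsim`): let `M` be weakly
perf-factorial with every prime component `M_𝔭 ≅ ℤ_{≥0}`; then an AUTOMORPHISM `α` of `M` with `α(a) ≼ a` for every
primary `a` is the identity.  Proof: `α(a) ≼ a` puts `α(a)` in the prime of `a`, so `α` (and `α⁻¹`, whose hypothesis
follows by symmetry of `≼` on primaries) maps each `M_𝔭` into itself, i.e. restricts to an automorphism of
`M_𝔭 ≅ (ℕ, +)` — necessarily the identity (abc-iut-w5-d250's `IsZMonoprime.mulEquiv_apply`); so `α` fixes every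
primary element, `α^pf` fixes every primary element of `M^pf` (roots of primary elements of `M`), hence every set
`Bound_{𝔮 ∪ {0}}(a)` and so the factorization map: `factorMap (α^pf a) = factorMap a`, and injectivity of the
factorization map (Def. 2.4 (i)(c)) and of `M → M^pf` (divisorial `M`) give `α = id`.  COROLLARIES:
`IsPerfFactorialWeak.isNonDilating_mulEquiv` / `isNonDilating_of_bijective` — **every automorphism (every bijective
endomorphism) of such a monoid is non-dilating**.  (The `ℤ`-monoprime hypothesis is used: `x ↦ x²` is a non-identity
automorphism of `ℚ_{≥0}` satisfying `α(a) ≼ a` for every `a`.)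

HONEST FRAMING: pure monoid algebra over [FrdI] §0 / Def. 1.1 (i) / Def. 2.4 (i) in the tree's renderings; used by
the EtTh §3 discharge files for `Div⁺(Z^log_∞)`, its Galois invariants and `Φ₀`; no side is taken on [IUTchIII]
Cor. 3.12; typed ≠ proved for anything else.
-/

namespace Literature.AlgebraicGeometry.Frobenioids

open Function

universe u


section Rigid

variable {N : Type u} [CommMonoid N]

/-- If `α(a) ≼ a` for every primary `a`, the same holds for `α⁻¹` (`≼` is symmetric on primary elements,
§0 p. 12). [cite: MochizukiFrdI2008, §0 p.12] -/
theorem precsim_mulEquiv_symm_apply_of_forall_isPrimary_precsim (α : N ≃* N)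
    (h : ∀ a : N, IsPrimary a → α a ≼ a) (a : N) (ha : IsPrimary a) : α.symm a ≼ a := by
  have hb : IsPrimary (α.symm a) := ha.map_mulEquiv α.symm
  have h1 : α (α.symm a) ≼ α.symm a := h _ hb
  rw [α.apply_symm_apply] at h1
  exact hb.2 a ha.1 h1

/-- An automorphism with `α(a) ≼ a` on primaries maps every prime component `M_𝔭 = 𝔭 ∪ {0}` into itself.
[cite: MochizukiFrdI2008, §0 p.12] -/
theorem mulEquiv_apply_mem_primesSubmonoid_of_forall_isPrimary_precsim (α : N ≃* N)
    (h : ∀ a : N, IsPrimary a → α a ≼ a) (𝔭 : Primes N) {x : N} (hx : x ∈ 𝔭.submonoid) :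
    α x ∈ 𝔭.submonoid := by
  obtain ⟨⟨p, hp'⟩, hp⟩ := Quotient.exists_rep 𝔭
  have hpc : p ∈ 𝔭.carrier := ⟨hp', hp⟩
  rcases (𝔭.mem_submonoid_iff hpc x).mp hx with rfl | hxc
  · rw [map_one]; exact 𝔭.submonoid.one_mem
  · have hxprim : IsPrimary x := hxc.fst
    exact (𝔭.mem_submonoid_iff hpc _).mpr
      (Or.inr (𝔭.mem_carrier_of_precsim hxc (hxprim.map_mulEquiv α).1 (h x hxprim)))

/-- **An automorphism `α` with `α(a) ≼ a` on primaries fixes every prime component pointwise** when the components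
are `ℤ`-monoprime: `α` restricts to an automorphism of `M_𝔭 ≅ (ℕ, +)`, which is the identity
(`IsZMonoprime.mulEquiv_apply`, `MonoprimeAutomorphisms.lean`).
[cite: MochizukiFrdI2008, Def. 1.1(i) p.19] -/
theorem mulEquiv_apply_eq_self_of_mem_primesSubmonoid (hZ : ∀ 𝔭 : Primes N, IsZMonoprime ↥𝔭.submonoid)
    (α : N ≃* N) (h : ∀ a : N, IsPrimary a → α a ≼ a) (𝔭 : Primes N) {x : N} (hx : x ∈ 𝔭.submonoid) :
    α x = x := by
  have hs := precsim_mulEquiv_symm_apply_of_forall_isPrimary_precsim α h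
  let β : ↥𝔭.submonoid ≃* ↥𝔭.submonoid :=
    { toFun := fun y => ⟨α y, mulEquiv_apply_mem_primesSubmonoid_of_forall_isPrimary_precsim α h 𝔭 y.2⟩
      invFun := fun y =>
        ⟨α.symm y, mulEquiv_apply_mem_primesSubmonoid_of_forall_isPrimary_precsim α.symm hs 𝔭 y.2⟩
      left_inv := fun y => Subtype.ext (α.symm_apply_apply y)
      right_inv := fun y => Subtype.ext (α.apply_symm_apply y)
      map_mul' := fun y z => Subtype.ext (map_mul α (y : N) (z : N)) }
  exact congrArg Subtype.val ((hZ 𝔭).mulEquiv_apply β ⟨x, hx⟩)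

/-- Under the same hypotheses `α` fixes every primary element. [cite: MochizukiFrdI2008, Def. 1.1(i) p.19] -/
theorem mulEquiv_apply_eq_self_of_isPrimary (hZ : ∀ 𝔭 : Primes N, IsZMonoprime ↥𝔭.submonoid)
    (α : N ≃* N) (h : ∀ a : N, IsPrimary a → α a ≼ a) {a : N} (ha : IsPrimary a) : α a = a :=
  mulEquiv_apply_eq_self_of_mem_primesSubmonoid hZ α h _
    (Submonoid.subset_closure (mem_carrier_mk_of_isPrimary ha))

/-- … and `α^pf = Perfection.congr α` fixes every primary element of `M^pf` (a root of a primary element of `M`,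
§0 p. 12, `M` sharp). [cite: MochizukiFrdI2008, §0 p.12] -/
theorem perfectionCongr_apply_eq_self_of_isPrimary (hN : IsSharp N)
    (hZ : ∀ 𝔭 : Primes N, IsZMonoprime ↥𝔭.submonoid) (α : N ≃* N) (h : ∀ a : N, IsPrimary a → α a ≼ a)
    {y : Perfection N} (hy : IsPrimary y) : Perfection.congr α y = y := by
  obtain ⟨⟨a, k⟩, rfl⟩ := Perfection.mk_surjective y
  dsimp only at hy ⊢
  have ha1 : a ≠ 1 := fun h1 => hy.1 (by rw [h1, Perfection.mk_one])
  have hofa : IsPrimary (Perfection.of N a) :=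
    hy.of_precsim (Perfection.mk_precsim_of a k).2
      (by rw [Perfection.of_apply, Ne, Perfection.mk_eq_one_iff_of_isSharp hN]; exact ha1)
  rw [Perfection.congr_mk, mulEquiv_apply_eq_self_of_isPrimary hZ α h ((Perfection.isPrimary_of_iff hN).mp hofa)]

/-- **Rigidity** ([FrdI] Def. 1.1 (i) for automorphisms): if `M` is weakly perf-factorial with `ℤ`-monoprime prime
components, an automorphism `α` of `M` with `α(a) ≼ a` for every primary `a ∈ M` is the identity — `α^pf` fixes
every `Bound_{𝔮 ∪ {0}}(a)`, hence the (injective) factorization map of Def. 2.4 (i)(c), and `M ↪ M^pf`.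
[cite: MochizukiFrdI2008, Def. 1.1(i) p.19; Def. 2.4(i) p.47] -/
theorem IsPerfFactorialWeak.mulEquiv_apply_eq_self_of_forall_isPrimary_precsim (hw : IsPerfFactorialWeak N)
    (hZ : ∀ 𝔭 : Primes N, IsZMonoprime ↥𝔭.submonoid) (α : N ≃* N) (h : ∀ a : N, IsPrimary a → α a ≼ a)
    (x : N) : α x = x := by
  have hN : IsSharp N := hw.isDivisorial.isSharp
  have hfix : ∀ y : Perfection N, IsPrimary y → Perfection.congr α y = y := fun y hy =>
    perfectionCongr_apply_eq_self_of_isPrimary hN hZ α h hy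
  have key : ∀ z : Perfection N, Perfection.congr α z = z := by
    intro z
    apply hw.factorMap_injective
    funext 𝔮
    change divSup (boundAt N 𝔮 (Perfection.congr α z)) = divSup (boundAt N 𝔮 z)
    congr 1
    ext w
    simp only [boundAt, Set.mem_setOf_eq]
    refine exists_congr fun x => and_congr_right fun hx => and_congr_left fun _ => ?_
    have hx1 : Perfection.congr α x.1 = x.1 := by
      rcases hx with hx | hx
      · exact hfix _ hx.1
      · rw [hx, Perfection.one_def, Perfection.congr_mk, map_one]
    have hx2 : (Perfection.congr α).symm x.1 = x.1 := (Perfection.congr α).symm_apply_eq.mpr hx1.symm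
    constructor
    · intro hd
      have hd' := map_dvd (Perfection.congr α).symm hd
      rwa [hx2, MulEquiv.symm_apply_apply] at hd'
    · intro hd
      have hd' := map_dvd (Perfection.congr α) hd
      rwa [hx1] at hd'
  have hx := key (Perfection.of N x)
  rw [Perfection.congr_of] at hx
  exact of_injective_of_isSharp_isIntegral_isSaturated hN hw.isDivisorial.isPreDivisorial.isIntegral
    hw.isDivisorial.isPreDivisorial.isSaturated hx

/-- **Every automorphism of a weakly perf-factorial monoid with `ℤ`-monoprime components is non-dilating**
([FrdI] Def. 1.1 (i); `M` is sharp, so `M^char = M`, abc-iut-L1's `isNonDilating_of_forall_isPrimary`).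
[cite: MochizukiFrdI2008, Def. 1.1(i) p.19] -/
theorem IsPerfFactorialWeak.isNonDilating_mulEquiv (hw : IsPerfFactorialWeak N)
    (hZ : ∀ 𝔭 : Primes N, IsZMonoprime ↥𝔭.submonoid) (α : N ≃* N) : IsNonDilating (α : N →* N) :=
  isNonDilating_of_forall_isPrimary hw.isDivisorial.isSharp _ fun h =>
    MonoidHom.ext fun x => hw.mulEquiv_apply_eq_self_of_forall_isPrimary_precsim hZ α h x

/-- The same for a bijective endomorphism `φ : M → M`. [cite: MochizukiFrdI2008, Def. 1.1(i) p.19] -/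
theorem IsPerfFactorialWeak.isNonDilating_of_bijective (hw : IsPerfFactorialWeak N)
    (hZ : ∀ 𝔭 : Primes N, IsZMonoprime ↥𝔭.submonoid) (φ : N →* N) (hφ : Bijective φ) : IsNonDilating φ := by
  have h := hw.isNonDilating_mulEquiv hZ (MulEquiv.ofBijective φ hφ)
  rwa [show ((MulEquiv.ofBijective φ hφ : N ≃* N) : N →* N) = φ from MonoidHom.ext fun _ => rfl] at h

end Rigid

end Literature.AlgebraicGeometry.Frobenioids
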